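import Mathlib
import Literature.MathematicalPhysics.QuantumFieldTheory.Balaban1983to89.B11Thm1

/-!
# `Balaban1983to89.B10NestedMinimizer` — [Balaban1985UV3] (T. Bałaban, *Ultraviolet stability of three-dimensional
# lattice pure gauge field theories*, CMP **102**, 255–275 (1985); cell paper B10): the NESTED (two-level) MINIMISER
# step of Sect. C, p. 268 — *"We take the minimal configuration V_k^{(k)} of the functional A^η(U_k) … If we substitute
# it in U_k in place of V_k↾Λ_k, we get the configuration U_{k+1}"* ((48)–(50); (52) at A = 0) — as KERNEL-PROVED
# bookkeeping over named leaves, with the by-name edge to Theorem 1 of [Balaban1985Variational] as typed in the tree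

CITATION HEADER (lean-in-tree rule 2026-08-18; audit cell `pub-balaban`, PAPER SUB-CELL B10, gen 4, unit
`b2b-balaban-b10-g4`).  A SIBLING module of `…Balaban1983to89.B10` (gen 1: Theorems 1–2, the tower carrier, (41),
(47)), `…B10LargeField` (gen 2) and `…B10LargeFieldSum` (gen 3); it imports none of them and modifies no existing file.
It imports `…B11Thm1` (surge node pv12; through it r2's carrier `…B11`) ONLY for the by-name edge of §4.  PDFs held:
`paper:balaban1985-cmp102-uv-stability-3d` (journal page = PDF page + 254; page renders re-opened for every quotation
below: pp. 258, 259, 266, 267, 268), `paper:balaban1985-cmp102-variational-background` (= reference [7] of the paper,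
cell paper B11; journal page = PDF page + 276; pp. 278, 279, 280) and, for the d = 4 twin sentence only,
`paper:balaban1987-cmp109-rg-i-small-field` (cell paper B12; journal page = PDF page + 248; p. 265).

WHAT IS REPRODUCED (statement level, verbatim in the docstrings, journal page [PDF page]):
* B10 p. 266 [12] (42): *"The configuration U_k is determined by the variational problem considered in [7], i.e. it is
  a minimum of the functional U → A^η(U), U: Ū^j = V_j on Λ_j, j = 0, 1, …, k, where we have put Λ₀ = Ω₁ᶜ and
  V_k = V. (42)"*; p. 268 [14]: *"We change the definition of Λ_k, taking Λ_k = Ω_k^{(k)}∖Ω_{k+1}^{(k)}, and we define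
  Λ_{k+1} = Ω_{k+1}^{(k+1)}, hence Ω_{k+1}^{(k)} = B(Λ_{k+1})."*, the split (48)/(49) of the integral over V_k into
  V_k↾Z_k, Z_k = B(Λ_{k+1})ᶜ, and V_k↾B(Λ_{k+1}), and the sentence quoted in the title, followed by (50) *"the only
  difference is that the configuration U₁ is replaced by V_k^{(k)}, which has the same properties as U₁"* and (52)
  *"U_k(exp i(A − D̃(A))V_k^{(k)}) = exp iη𝓗(A − D̃(A))U_{k+1} (modulo a gauge transformation), (52)"* — whose
  instance A = 0 reads U_k(V₀, …, V_{k−1}, V_k^{(k)}) = U_{k+1} modulo a gauge transformation.  These are gathered into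
  ONE schematic carrier `StepData` (§2) naming the printed objects of one induction step k → k + 1: configurations U,
  the k-data (V₀↾Λ₀, …, V_{k−1}↾Λ_{k−1}; V_k↾Ω_k^{(k)}) that (42) constrains, the (k+1)-data (…; V_k↾Λ_k (new Λ_k);
  V↾Λ_{k+1}) that (42) at level k + 1 constrains, the datum maps U ↦ (Ū^j↾Λ_j)_j and the coarsening of a k-datum to a
  (k+1)-datum (one more block average: Ū^{k+1} = \overline{Ū^k}), the action A^η, the minimiser maps U_k(·), U_{k+1}(·)
  of [7] Theorem 1, the regular spaces (6)/(8) of [7] at the two levels, the admissible data ((7) of [7]), the gauge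
  orbits and the criticality notions of [7].
* [7] = B11: p. 278 [2] (2)–(6) and *"Our problem is to find all critical orbits of the functional (5). … More exactly,
  we will prove that there exists a minimal orbit. Elements of the minimal orbit are called minimal configurations."*;
  Theorem 1 p. 279 [3] BY NAME (`B11.Thm1Printed`, `B11Thm1.Thm1At`, `B11Thm1.Exists8`, `B11Thm1.Unique6`); p. 280 [4]
  (13)–(14) *"From the conditions (11), and from the form (2) of the regularity conditions, it follows that
  U₀ ∈ 𝔘_k({Ω_j}, B₃L³ε₁) ∩ 𝔅_k(𝔅_k, V), (13)"*, *"The configuration U₀ constructed above satisfies (14) with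
  C₁ = L³."* (the printed instance of the scale-change of the regularity constants used in leaf (L4) below).
* B12 p. 265 [17] (2.2)–(2.3), the d = 4 twin of the step (recorded in §3, nothing of B12 is typed here; the cell's
  B12 modules are owned by other seats): *"Under the above regularity assumptions there exists the exactly one critical
  point, which is obtained by taking the critical orbit of the function A(U_k(V)) considered on the subspace, and
  choosing the element of the orbit satisfying the axial gauge conditions G(V) = 0. This critical configuration, which is
  a minimum of the function (2.2), is denoted by V^{(k)} = V^{(k)}(W), and is related to the minimal configuration
  U_{k+1}(W) in the axial gauge by the equality V^{(k)} = Ū^k_{k+1} = M^k(U_{k+1}). (2.3)"*.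

WHAT IS PROVED (kernel; elementary order-theoretic bookkeeping — "a minimiser of the effective functional of a
constrained minimiser is a minimiser of the composite constrained problem" — in the exact shape the two papers use it,
with every analytic input a NAMED HYPOTHESIS):
* §1 (abstract, sets and functions only; configurations X, k-data Y, (k+1)-data W, action F, datum map C, coarsening
  D, admissible data T, level-k comparison regions R y, minimiser map Uk; `LevelMin F C R T Uk` = "for admissible y,
  Uk y has datum y, lies in R y and minimises F over R y ∩ {C x = y}"):
  `LevelMin.isMinOn_compSp_of_isMinOn_eff` (BOTTOM-UP = B10's sentence: an effective minimiser y⋆ of y ↦ F(Uk y) over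
  the admissible data coarsening to w gives a minimiser Uk y⋆ of F over the composite region
  `compSp` = {x ∈ R (C x), C x ∈ T, D (C x) = w}); `LevelMin.isMinOn_compSp_datum`, `LevelMin.isMinOn_eff_datum`
  (TOP-DOWN = B12 (2.3)'s direction: a composite minimiser x₁ gives the composite minimiser Uk (C x₁) with the same
  action and the effective minimiser C x₁), `LevelMin.exists_eff_min_of_compSp_min` (existence transfer),
  `LevelMin.eff_min_value_eq`; uniqueness transfer modulo an equivalence ("modulo a gauge transformation"):
  `LevelMin.rel_of_unique_min`, `LevelMin.relY_eff_of_unique_min`, `LevelMin.eff_min_unique_mod`,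
  `eff_min_eq_on_slice` (axial-gauge slice ⇒ equality); the penalty form of B12 (2.2) (G ≥ 0 vanishing on the slice):
  `isMinOn_penalty_of_isMinOn`, `penalty_zero_of_isMinOn`; the CRITICAL-ORBIT route that [7] Theorem 1's uniqueness
  clause actually supplies: `rel_uk_datum_of_crit` (B12 (2.3) / cell GAPS C-adv7-6 (L2): critical on the composite
  constraint set ⇒ critical on the level-k fibre through the point ⇒ on the orbit of Uk (C x₁)),
  `LevelMin.rel_uk_eff_of_unique_crit` (B10 p. 268: effective minimiser ⇒ composite minimiser ⇒ critical ⇒ on the orbit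
  of U_{k+1}), and `isMinOn_of_exists_min_of_unique_crit` (how "minimal in (8), unique critical in (6)" upgrades to
  "minimal in (6)" GIVEN interior attainment — the upgrade no consumer is shown to need, cell GAPS C-adv7-6).
* §2 (the B10 instance over `StepData`): `StepData.gauge_Uk_substitute_Usucc` = the title sentence / (52) at A = 0
  from the leaves (L1) [7] Thm 1 at level k, minimality in (8)_k; (L2) V_k^{(k)} an effective minimiser (B10's own
  definition of V_k^{(k)}); (L3) a minimiser over a relatively open piece of 𝔅_{k+1}(w) is critical on 𝔅_{k+1}(w);
  (L4) scale change U_k(V_k^{(k)}) ∈ (6)_{k+1} ([7] (13)–(14) type, "C₁ = L³"); (L5) [7] Thm 1 at level k + 1,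
  uniqueness of the critical orbit in (6)_{k+1}; `StepData.gauge_Usucc_Uk_datum` = the B12 (2.3) direction from
  (M0) restriction of criticality to the level-k fibre, (M3) (8)_{k+1} ⊆ (6)_k, (M4) averages of regular
  configurations are admissible data ([4] = B7 Prop. 1/2, as [7] p. 278 invokes it), (M5) [7] Thm 1 at level k,
  uniqueness; `StepData.exists_Vkk_of_Usucc_min`, `StepData.Vkk_unique_mod_gauge` (+ `LevelMin.unique_min_of_unique_crit`,
  `LevelMin.mono`); `eps0_window`, `eps0_window_L3` (the ε₀-window c₂B₃ε₁^{(k+1)} ≤ ε₀, c₁B₃ε₁^{(k)} ≤ ε₀ ≤ a₀ the two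
  uses of [7] Thm 1 need is non-empty iff both lower bounds are ≤ a₀; with [7]'s printed scale change c₁ = L³, c₂ = 1
  and ε₁^{(k)} ≤ ε₁^{(k+1)} one condition L³B₃ε₁^{(k+1)} ≤ a₀ — "for g_k sufficiently small", as p. 259 [5] *"For g₀
  sufficiently small 2L²g₀p(g₀) < a₁"* says for the first step).
* §4 (edge IN THE TREE): `levelMin_of_thm1At` — `B11Thm1.Thm1At C P` (Theorem 1 of [7] at given constants, pv12) plus
  an explicit DICTIONARY `B11Dict` (r2's primitive `OnMinimalOrbit` READ as "minimises the action over 𝔘(e) ∩ 𝔅(V)",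
  r2's `InB V U` READ as "the datum of U is V", r2's `UniqueCriticalOrbit` READ as "every critical configuration of (5)
  in (6) lies on the orbit" — hypotheses, never asserted; cf. `B11.VarProblemX.Laws`) yield leaf (L1) with
  R = (8)_k = 𝔘_k({Ω_j}, B₃ε₁) and T = {V : (7) with ε₁}, and leaf (L5)/(M5) in the shape used in §2
  (`levelMin_of_thm1Printed` = the same from r2's family form; `sameOrbit_of_atMostOne` = (L5) from r2's typed notion
  of Prop. 7, `B11.VarProblemX.AtMostOneCriticalOrbit`, without dictionary clause (iii)).

WHAT IS NOT HERE (the located residue, cell GAPS G-B10-08 (i) → C-B10-8 / G-B10-11): the leaves themselves — (L3)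
"local minimum on an open piece of the constraint manifold ⇒ critical" and the openness of (2), (7) (strict
inequalities) [not printed in B10/B11; standard]; (L4) the scale-change membership with ITS constant (B11 prints the
instance (13)–(14), C₁ = L³, for its own k − 1 → k; B10 prints nothing); (M4) regularity of averages ([4] Props. 1–2);
the EXISTENCE of V_k^{(k)} as B10 defines it (an effective minimiser) — supplied by `exists_eff_min_of_compSp_min`
only from a composite minimiser over the LEVEL-k-regular composite region, which [7] Thm 1 (8) at level k + 1 does not
literally provide at B10's constants (ε₁^{(k+1)} = 2L²g_kp(g_k) > ε₁^{(k)} = 2L²g_{k−1}p(g_{k−1}): the inclusions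
between (8)_k and (8)_{k+1} go the wrong way in both directions), whereas B12 (2.3) DEFINES V^{(k)} := M^k(U_{k+1}) and
then only the critical-orbit route is needed; which gauge group "(modulo a gauge transformation)" of (52) refers to
((4) of [7] at level k or k + 1) — the relation `Gauge` is a parameter here (cell DIVERGENCE D-b10.8).  No lattice, no
group, no action formula is modelled: the carrier only NAMES (42)'s objects (DIVERGENCE D-b10.8).  Value = kernel
bookkeeping of a located by-reference step + its leaves located, NOT summit progress; d = 3 plays no role in this module.
-/

namespace Literature.MathematicalPhysics.QuantumFieldTheory.Balaban1983to89.B10NestedMinimizer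

open Literature.MathematicalPhysics.QuantumFieldTheory.Balaban1983to89

/-! ## §1. Two-level constrained minimisation (abstract: sets and functions only)

Dictionary for the whole section (B10 (42), p. 266 [12]; p. 268 [14]): `X` = gauge field configurations U on the
fine lattice (the argument of A^η); `Y` = k-data y = (V₀↾Λ₀, …, V_{k−1}↾Λ_{k−1}; V_k↾Ω_k^{(k)}) — what (42) at level k
prescribes ("Ū^j = V_j on Λ_j, j = 0, 1, …, k", old Λ_k = Ω_k^{(k)}, V_k = V); `W` = (k+1)-data w = (V₀↾Λ₀, …,
V_{k−1}↾Λ_{k−1}; V_k↾Λ_k with the NEW Λ_k = Ω_k^{(k)}∖Ω_{k+1}^{(k)}; V↾Λ_{k+1}), Λ_{k+1} = Ω_{k+1}^{(k+1)}; `F` = A^η;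
`C : X → Y` = U ↦ ((Ū^j↾Λ_j)_{j<k}, Ū^k↾Ω_k^{(k)}); `D : Y → W` = y ↦ (its components on Λ_j, j < k; y_k↾Λ_k;
ȳ_k↾Λ_{k+1}) (one more block average, so that D (C U) = ((Ū^j↾Λ_j)_{j≤k}, Ū^{k+1}↾Λ_{k+1}) is the (k+1)-datum of U —
the identity Ū^{k+1} = \overline{Ū^k} of [4] is built into the MEANING of `D`); `T ⊆ Y` = admissible k-data ((7) of
[7] with the ε₁ at which [7] Thm 1 is applied at level k, incl. the small-field restrictions of (49)); `R y ⊆ X` = the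
region in which U_k(y) is known to minimise (the space (8) of [7] at level k in the global reading; a neighbourhood of
the orbit in the local reading, cell DIVERGENCE D-B11-2); `Uk : Y → X` = y ↦ U_k(y), a chosen minimal configuration.
The effective problem of (49): minimise y ↦ F (Uk y) over `effFib D T w` = {y ∈ T : D y = w} ("V_k↾Z_k = given,
\overline{V_k} = V on Λ_{k+1}"); the composite problem = (42) at level k + 1 over the comparison region `compSp`. -/

section Abstract

variable {X Y W : Type*}

/-- The level-k fibre {U : C U = y} — the constraint "Ū^j = V_j on Λ_j, j = 0, …, k" of (42) for the k-datum y.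
[cite: Balaban1985UV3, (42) p.266] -/
def fibK (C : X → Y) (y : Y) : Set X := {x | C x = y}

/-- The composite ((k+1)-level) fibre {U : D (C U) = w} — the constraint of (42) at level k + 1 for the (k+1)-datum w
(p. 268 [14]: data V_j on Λ_j, j < k, V_k on the new Λ_k, V on Λ_{k+1}). [cite: Balaban1985UV3, (42) p.266, p.268] -/
def fibK1 (C : X → Y) (D : Y → W) (w : W) : Set X := {x | D (C x) = w}

/-- The effective fibre {y ∈ T : D y = w} over which p. 268 [14] minimises y ↦ A^η(U_k(y)): *"the minimal
configuration V_k^{(k)} of the functional A^η(U_k), which satisfies the conditions V_k^{(k)}↾Z_k = V_k↾Z_k,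
\overline{V_k^{(k)}} = V on Λ_{k+1}"* (admissibility `T` = the regularity (7) of [7] + the small-field restrictions of
(49), under which U_k(y) is defined). [cite: Balaban1985UV3, (49) p.268] -/
def effFib (D : Y → W) (T : Set Y) (w : W) : Set Y := {y | y ∈ T ∧ D y = w}

/-- The composite comparison region over w: configurations x lying in the level-k region R (C x) attached to their own
k-datum, whose k-datum is admissible and coarsens to w.  (For R y = the space (8) of [7] at level k and T = data with
(7): "the (k+1)-constraint set (42)_{k+1} ∩ level-k regular configurations with regular averages".)
[cite: Balaban1985UV3, (42) p.266, p.268] -/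
def compSp (R : Y → Set X) (C : X → Y) (D : Y → W) (T : Set Y) (w : W) : Set X :=
  {x | x ∈ R (C x) ∧ C x ∈ T ∧ D (C x) = w}

/-- Membership in the level-k fibre, by definition. [folklore] -/
@[simp] theorem mem_fibK (C : X → Y) (y : Y) (x : X) : x ∈ fibK C y ↔ C x = y := Iff.rfl

/-- Membership in the composite fibre, by definition. [folklore] -/
@[simp] theorem mem_fibK1 (C : X → Y) (D : Y → W) (w : W) (x : X) : x ∈ fibK1 C D w ↔ D (C x) = w := Iff.rfl

/-- Membership in the effective fibre, by definition. [folklore] -/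
@[simp] theorem mem_effFib (D : Y → W) (T : Set Y) (w : W) (y : Y) : y ∈ effFib D T w ↔ y ∈ T ∧ D y = w :=
  Iff.rfl

/-- Membership in the composite comparison region, by definition. [folklore] -/
@[simp] theorem mem_compSp (R : Y → Set X) (C : X → Y) (D : Y → W) (T : Set Y) (w : W) (x : X) :
    x ∈ compSp R C D T w ↔ x ∈ R (C x) ∧ C x ∈ T ∧ D (C x) = w := Iff.rfl

/-- Each level-k fibre lies in one composite fibre: {C x = y} ⊆ {D (C x) = D y} — "the (k+1)-constraint set is a union
of level-k constraint sets" (the geometric content of p. 268's substitution). [folklore] -/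
theorem fibK_subset_fibK1 (C : X → Y) (D : Y → W) (y : Y) : fibK C y ⊆ fibK1 C D (D y) := by
  intro x hx
  rw [mem_fibK] at hx
  rw [mem_fibK1, hx]

/-- The composite comparison region lies in the composite fibre. [folklore] -/
theorem compSp_subset_fibK1 (R : Y → Set X) (C : X → Y) (D : Y → W) (T : Set Y) (w : W) :
    compSp R C D T w ⊆ fibK1 C D w := fun _ hx => hx.2.2

/-- Enlarging the level-k regions enlarges the composite region (global ⊇ local reading). [folklore] -/
theorem compSp_mono {R R' : Y → Set X} (h : ∀ y, R y ⊆ R' y) (C : X → Y) (D : Y → W) (T : Set Y) (w : W) :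
    compSp R C D T w ⊆ compSp R' C D T w := fun _ hx => ⟨h _ hx.1, hx.2.1, hx.2.2⟩

/-- The k-datum of a configuration of the composite region lies in the effective fibre. [folklore] -/
theorem datum_mem_effFib {R : Y → Set X} {C : X → Y} {D : Y → W} {T : Set Y} {w : W} {x : X}
    (hx : x ∈ compSp R C D T w) : C x ∈ effFib D T w := ⟨hx.2.1, hx.2.2⟩

/-- **Level-k minimality package** — the reading of [7] Theorem 1 at level k that the step consumes (B10 p. 266 [12]
(42) *"it is a minimum of the functional U → A^η(U), U: Ū^j = V_j on Λ_j, j = 0, 1, …, k"*): for every admissible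
k-datum y ∈ T the chosen minimal configuration `Uk y` lies in the region `R y`, has datum y, and its action is ≤ the
action of every configuration of `R y` with datum y.  A HYPOTHESIS of everything below (supplied from `B11Thm1.Thm1At`
under an explicit dictionary in §4, with R y = the space (8) of [7]); never asserted.
[cite: Balaban1985UV3, (42) p.266; Balaban1985Variational, Thm 1 (8) p.279] -/
structure LevelMin (F : X → ℝ) (C : X → Y) (R : Y → Set X) (T : Set Y) (Uk : Y → X) : Prop where
  mem : ∀ y ∈ T, Uk y ∈ R y
  datum : ∀ y ∈ T, C (Uk y) = y
  isMin : ∀ y ∈ T, ∀ x ∈ R y, C x = y → F (Uk y) ≤ F x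

namespace LevelMin

variable {F : X → ℝ} {C : X → Y} {R : Y → Set X} {T : Set Y} {Uk : Y → X}

/-- `LevelMin` in Mathlib's vocabulary: Uk y is a minimum of F on R y ∩ {C x = y}. [folklore] -/
theorem isMinOn_fib (h : LevelMin F C R T Uk) {y : Y} (hy : y ∈ T) : IsMinOn F (R y ∩ fibK C y) (Uk y) :=
  isMinOn_iff.2 fun x hx => h.isMin y hy x hx.1 hx.2

/-- Restricting the admissible data (e.g. to the small-field domain of the characteristic functions χ of (49)) keeps
the package. [folklore] -/
theorem mono (h : LevelMin F C R T Uk) {T' : Set Y} (hT : T' ⊆ T) : LevelMin F C R T' Uk :=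
  ⟨fun y hy => h.mem y (hT hy), fun y hy => h.datum y (hT hy), fun y hy => h.isMin y (hT hy)⟩

/-- U_k(y) belongs to the composite comparison region over D y (its datum is y: admissible, coarsening to D y).
[folklore] -/
theorem uk_mem_compSp (h : LevelMin F C R T Uk) (D : Y → W) {w : W} {y : Y} (hy : y ∈ T) (hw : D y = w) :
    Uk y ∈ compSp R C D T w := by
  refine ⟨?_, ?_, ?_⟩
  · rw [h.datum y hy]; exact h.mem y hy
  · rw [h.datum y hy]; exact hy
  · rw [h.datum y hy]; exact hw

/-- **BOTTOM-UP (B10 p. 268 [14], the title sentence).**  If y⋆ (= V_k^{(k)} together with the frozen data) minimises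
the effective functional y ↦ F (Uk y) over the admissible data coarsening to w, then Uk y⋆ (= U_k(V₀, …, V_{k−1},
V_k^{(k)})) lies in the composite region over w and MINIMISES F there: for x in the region, F x ≥ F (Uk (C x)) (level-k
minimality at the datum of x) ≥ F (Uk y⋆) (effective minimality, C x being admissible and coarsening to w).  This is the
order-theoretic content of *"If we substitute it in U_k in place of V_k↾Λ_k, we get the configuration U_{k+1}"*; the
identification with [7]'s U_{k+1} modulo gauge is `rel_uk_eff_of_unique_crit` / `rel_of_unique_min` below.
[cite: Balaban1985UV3, (48)–(50) p.268] -/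
theorem isMinOn_compSp_of_isMinOn_eff (h : LevelMin F C R T Uk) (D : Y → W) {w : W} {ys : Y}
    (hys : ys ∈ effFib D T w) (hmin : IsMinOn (F ∘ Uk) (effFib D T w) ys) :
    Uk ys ∈ compSp R C D T w ∧ IsMinOn F (compSp R C D T w) (Uk ys) := by
  refine ⟨h.uk_mem_compSp D hys.1 hys.2, isMinOn_iff.2 fun x hx => ?_⟩
  have h1 : F (Uk ys) ≤ F (Uk (C x)) := isMinOn_iff.1 hmin (C x) ⟨hx.2.1, hx.2.2⟩
  exact h1.trans (h.isMin (C x) hx.2.1 x hx.1 rfl)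

/-- **TOP-DOWN (B12 p. 265 [17] (2.3)'s direction; also B10 read backwards).**  If x₁ (= U_{k+1}) minimises F over the
composite region over w and lies in it, then Uk (C x₁) (= U_k(Ū^k_{k+1}) = U_k(M^k(U_{k+1}))) lies in the region, has
the SAME action, and minimises F there too. [cite: Balaban1985UV3, (42) p.266, p.268; Balaban1987RG1, (2.3) p.265] -/
theorem isMinOn_compSp_datum (h : LevelMin F C R T Uk) (D : Y → W) {w : W} {x₁ : X}
    (hx : x₁ ∈ compSp R C D T w) (hmin : IsMinOn F (compSp R C D T w) x₁) :
    F (Uk (C x₁)) = F x₁ ∧ Uk (C x₁) ∈ compSp R C D T w ∧ IsMinOn F (compSp R C D T w) (Uk (C x₁)) := by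
  have hmem : Uk (C x₁) ∈ compSp R C D T w := h.uk_mem_compSp D hx.2.1 hx.2.2
  have hle : F (Uk (C x₁)) ≤ F x₁ := h.isMin (C x₁) hx.2.1 x₁ hx.1 rfl
  have hge : F x₁ ≤ F (Uk (C x₁)) := isMinOn_iff.1 hmin _ hmem
  exact ⟨le_antisymm hle hge, hmem, isMinOn_iff.2 fun x hx' => hle.trans (isMinOn_iff.1 hmin x hx')⟩

/-- **TOP-DOWN, effective side (B12 (2.3): "V^{(k)} = Ū^k_{k+1} … is a minimum of the function (2.2)" at G = 0).**
The k-datum C x₁ of a composite minimiser x₁ is admissible, coarsens to w, and minimises the effective functional over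
the admissible data coarsening to w. [cite: Balaban1987RG1, (2.2)–(2.3) p.265; Balaban1985UV3, p.268] -/
theorem isMinOn_eff_datum (h : LevelMin F C R T Uk) (D : Y → W) {w : W} {x₁ : X}
    (hx : x₁ ∈ compSp R C D T w) (hmin : IsMinOn F (compSp R C D T w) x₁) :
    C x₁ ∈ effFib D T w ∧ IsMinOn (F ∘ Uk) (effFib D T w) (C x₁) := by
  refine ⟨⟨hx.2.1, hx.2.2⟩, isMinOn_iff.2 fun y hy => ?_⟩
  show F (Uk (C x₁)) ≤ F (Uk y)
  rw [(h.isMinOn_compSp_datum D hx hmin).1]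
  exact isMinOn_iff.1 hmin _ (h.uk_mem_compSp D hy.1 hy.2)

/-- **Existence transfer.**  A composite minimiser IN the composite region yields an effective minimiser (its own
k-datum) — the form in which B12 (2.3) DEFINES V^{(k)} := M^k(U_{k+1}).  For B10, whose V_k^{(k)} is defined as an
effective minimiser ("We take the minimal configuration V_k^{(k)} of the functional A^η(U_k)", p. 268 — existence
asserted, not argued), this is the only source of existence in the two papers; NOTE that its hypothesis is minimality
of U_{k+1} over the LEVEL-k-regular composite region `compSp R …`, which [7] Thm 1 (8) at level k + 1 (minimality over
the level-(k+1) space (8)) does not literally give at B10's constants (cell GAPS G-B10-11). [cite: Balaban1985UV3,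
p.268; Balaban1987RG1, (2.3) p.265] -/
theorem exists_eff_min_of_compSp_min (h : LevelMin F C R T Uk) (D : Y → W) {w : W}
    (hex : ∃ x₁ ∈ compSp R C D T w, IsMinOn F (compSp R C D T w) x₁) :
    ∃ y ∈ effFib D T w, IsMinOn (F ∘ Uk) (effFib D T w) y := by
  obtain ⟨x₁, hx, hmin⟩ := hex
  exact ⟨C x₁, (h.isMinOn_eff_datum D hx hmin).1, (h.isMinOn_eff_datum D hx hmin).2⟩

/-- The effective minimum equals the composite minimum: A^η(U_k(…, V_k^{(k)})) = A^η(U_{k+1}) — the value the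
expansion (50)–(52) is performed around. [cite: Balaban1985UV3, (49)–(52) p.268] -/
theorem eff_min_value_eq (h : LevelMin F C R T Uk) (D : Y → W) {w : W} {ys : Y} {x₁ : X}
    (hys : ys ∈ effFib D T w) (hmin : IsMinOn (F ∘ Uk) (effFib D T w) ys)
    (hx : x₁ ∈ compSp R C D T w) (hmin₁ : IsMinOn F (compSp R C D T w) x₁) : F (Uk ys) = F x₁ := by
  have hB := h.isMinOn_compSp_of_isMinOn_eff D hys hmin
  exact le_antisymm (isMinOn_iff.1 hB.2 x₁ hx) (isMinOn_iff.1 hmin₁ _ hB.1)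

/-- **Uniqueness transfer, minimiser form ("modulo a gauge transformation", (52) p. 268).**  If any two minimisers of
F over the composite region are related by `rel` (uniqueness of the minimal orbit of (42)_{k+1}), then U_k(…, V_k^{(k)})
is related to every composite minimiser x₁ (= U_{k+1}). [cite: Balaban1985UV3, (52) p.268] -/
theorem rel_of_unique_min (h : LevelMin F C R T Uk) (D : Y → W) {w : W} (rel : X → X → Prop)
    (huniq : ∀ x ∈ compSp R C D T w, ∀ x' ∈ compSp R C D T w,
      IsMinOn F (compSp R C D T w) x → IsMinOn F (compSp R C D T w) x' → rel x x')
    {ys : Y} {x₁ : X} (hys : ys ∈ effFib D T w) (hmin : IsMinOn (F ∘ Uk) (effFib D T w) ys)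
    (hx : x₁ ∈ compSp R C D T w) (hmin₁ : IsMinOn F (compSp R C D T w) x₁) : rel (Uk ys) x₁ :=
  have hB := h.isMinOn_compSp_of_isMinOn_eff D hys hmin
  huniq _ hB.1 _ hx hB.2 hmin₁

/-- Same, on the data side: if the datum map carries `rel` (gauge equivalence of configurations) to `relY` (the induced
equivalence of k-data — *"The gauge covariance of the averages"*, B12 p. 265 [17]), then V_k^{(k)} is `relY`-related to
the k-datum C x₁ of every composite minimiser: B12 (2.3) "V^{(k)} = M^k(U_{k+1})" modulo gauge.
[cite: Balaban1987RG1, (2.3) p.265; Balaban1985UV3, (52) p.268] -/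
theorem relY_eff_of_unique_min (h : LevelMin F C R T Uk) (D : Y → W) {w : W} (rel : X → X → Prop)
    (relY : Y → Y → Prop) (hC : ∀ x x', rel x x' → relY (C x) (C x'))
    (huniq : ∀ x ∈ compSp R C D T w, ∀ x' ∈ compSp R C D T w,
      IsMinOn F (compSp R C D T w) x → IsMinOn F (compSp R C D T w) x' → rel x x')
    {ys : Y} {x₁ : X} (hys : ys ∈ effFib D T w) (hmin : IsMinOn (F ∘ Uk) (effFib D T w) ys)
    (hx : x₁ ∈ compSp R C D T w) (hmin₁ : IsMinOn F (compSp R C D T w) x₁) : relY ys (C x₁) := by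
  have := hC _ _ (h.rel_of_unique_min D rel huniq hys hmin hx hmin₁)
  rwa [h.datum ys hys.1] at this

/-- Two effective minimisers are `relY`-related (uniqueness of V_k^{(k)} "modulo a gauge transformation").
[cite: Balaban1985UV3, p.268; Balaban1987RG1, p.265] -/
theorem eff_min_unique_mod (h : LevelMin F C R T Uk) (D : Y → W) {w : W} (rel : X → X → Prop)
    (relY : Y → Y → Prop) (hC : ∀ x x', rel x x' → relY (C x) (C x'))
    (huniq : ∀ x ∈ compSp R C D T w, ∀ x' ∈ compSp R C D T w,
      IsMinOn F (compSp R C D T w) x → IsMinOn F (compSp R C D T w) x' → rel x x')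
    {ys ys' : Y} (hys : ys ∈ effFib D T w) (hmin : IsMinOn (F ∘ Uk) (effFib D T w) ys)
    (hys' : ys' ∈ effFib D T w) (hmin' : IsMinOn (F ∘ Uk) (effFib D T w) ys') : relY ys ys' := by
  have hB := h.isMinOn_compSp_of_isMinOn_eff D hys hmin
  have hB' := h.isMinOn_compSp_of_isMinOn_eff D hys' hmin'
  have := hC _ _ (huniq _ hB.1 _ hB'.1 hB.2 hB'.2)
  rwa [h.datum ys hys.1, h.datum ys' hys'.1] at this

end LevelMin

/-- **Axial-gauge slice ⇒ equality** (B12 p. 265 [17]: *"choosing the element of the orbit satisfying the axial gauge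
conditions G(V) = 0"*; B10 (49) carries δ_{Ax(B(Λ_{k+1}))}(V_k)): if `relY`-classes meet the slice `Ax` in at most one
point, two `relY`-related points of the slice are equal — so an effective minimiser in the slice is unique outright.
[cite: Balaban1987RG1, (2.2) p.265; Balaban1985UV3, (49) p.268] -/
theorem eff_min_eq_on_slice {relY : Y → Y → Prop} {Ax : Set Y}
    (hAx : ∀ y ∈ Ax, ∀ y' ∈ Ax, relY y y' → y = y') {ys ys' : Y} (hys : ys ∈ Ax) (hys' : ys' ∈ Ax)
    (hrel : relY ys ys') : ys = ys' :=
  hAx ys hys ys' hys' hrel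

/-- **Penalty form of B12 (2.2), first half**: if P ≥ 0 on E (the gauge-fixing term 𝐆(V)) and y₀ ∈ E with P y₀ = 0
minimises f (= A(U_k(·))) on E, then y₀ minimises P + f on E — *"This critical configuration, which is a minimum of the
function (2.2)"* given minimality of A∘U_k and 𝐆(V^{(k)}) = 0. [cite: Balaban1987RG1, (2.2) p.265] -/
theorem isMinOn_penalty_of_isMinOn {E : Set Y} {f P : Y → ℝ} (hP : ∀ y ∈ E, 0 ≤ P y) {y₀ : Y} (hy₀ : y₀ ∈ E)
    (hP₀ : P y₀ = 0) (hmin : IsMinOn f E y₀) : IsMinOn (fun y => P y + f y) E y₀ := by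
  refine isMinOn_iff.2 fun y hy => ?_
  have h1 : f y₀ ≤ f y := isMinOn_iff.1 hmin y hy
  have h2 := hP y hy
  have _ := hy₀
  show P y₀ + f y₀ ≤ P y + f y
  rw [hP₀]
  linarith

/-- **Penalty form of B12 (2.2), second half**: conversely, a minimiser y of P + f on E has P y = 0 and minimises f on
E, provided every point of E is dominated by a point of the slice {P = 0} ∩ E with no larger f (every gauge orbit meets
the axial slice and f is gauge invariant) — *"obtained by taking the critical orbit of the function A(U_k(V)) considered
on the subspace, and choosing the element of the orbit satisfying the axial gauge conditions G(V) = 0"*, minimum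
version. [cite: Balaban1987RG1, (2.2) p.265] -/
theorem penalty_zero_of_isMinOn {E : Set Y} {f P : Y → ℝ} (hP : ∀ y ∈ E, 0 ≤ P y) {y : Y} (hy : y ∈ E)
    (hmin : IsMinOn (fun y => P y + f y) E y)
    (hrep : ∀ y' ∈ E, ∃ y'' ∈ E, P y'' = 0 ∧ f y'' ≤ f y') : P y = 0 ∧ IsMinOn f E y := by
  obtain ⟨y₀, hy₀, hP₀, hf₀⟩ := hrep y hy
  have h1 : P y + f y ≤ P y₀ + f y₀ := isMinOn_iff.1 hmin y₀ hy₀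
  rw [hP₀, zero_add] at h1
  have hPy : P y = 0 := le_antisymm (by linarith [hP y hy]) (hP y hy)
  refine ⟨hPy, isMinOn_iff.2 fun y' hy' => ?_⟩
  obtain ⟨y'', hy'', hP'', hf''⟩ := hrep y' hy'
  have h2 : P y + f y ≤ P y'' + f y'' := isMinOn_iff.1 hmin y'' hy''
  rw [hP'', zero_add, hPy, zero_add] at h2
  exact h2.trans hf''

/-! ### The critical-orbit route (what [7] Theorem 1's uniqueness clause literally supplies)

[7] p. 278 [2]: *"Our problem is to find all critical orbits of the functional (5)."*; Theorem 1 p. 279 [3]: *"This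
orbit is a unique critical orbit in the space (6) if B₃ε₁ ≤ ε₀ and ε₀ ≤ a₀."*  Criticality is taken as two primitive
predicates — `CritK y x` : "x is a critical configuration of (5) on the level-k constraint manifold 𝔅_k(y)" (r2's
`B11.VarProblemX.IsCritical`), `CritK1 w x` : the same at level k + 1 — linked by ONE law: critical on the composite
constraint manifold through x ⇒ critical on the level-k fibre through x (its sub-manifold; for criticality defined
through smooth curves in the constraint set this is immediate: a curve in the fibre is a curve in the composite set).
The law is a hypothesis (cell GAPS C-adv7-2 (i) certified the fibration argument at one scale). -/

/-- The restriction law for a criticality notion indexed by constraint SETS: critical on S at x, S′ ⊆ S, x ∈ S′ ⇒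
critical on S′ at x (valid for "d/dt F(γ(t))|₀ = 0 for every smooth curve γ in the set through x"). [folklore] -/
def CritRestricts (Crit : Set X → X → Prop) : Prop :=
  ∀ (S S' : Set X) (x : X), Crit S x → S' ⊆ S → x ∈ S' → Crit S' x

/-- From a set-indexed criticality notion obeying restriction, the level-indexed predicates CritK y := Crit {C · = y},
CritK1 w := Crit {D (C ·) = w} obey the law used below: critical on the composite fibre through x ⇒ critical on the
level-k fibre through x. [folklore] -/
theorem critLaw_of_restricts {Crit : Set X → X → Prop} (hres : CritRestricts Crit) (C : X → Y) (D : Y → W) (x : X)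
    (hcrit : Crit (fibK1 C D (D (C x))) x) : Crit (fibK C (C x)) x :=
  hres _ _ x hcrit (fibK_subset_fibK1 C D (C x)) rfl

/-- **B12 (2.3) / cell GAPS C-adv7-6 (L2): U_{k+1} ∼ U_k(Ū^k_{k+1}).**  If U₁ (= U_{k+1}(w)) is critical on the
composite constraint manifold of its own (k+1)-datum, then (law) it is critical on the level-k fibre of its own k-datum
y₁ = C U₁; if moreover U₁ lies in the level-k uniqueness region `R6` (the space (6) of [7] at level k: leaf
"(8)_{k+1} ⊆ (6)_k", drop the Ω_{k+1}-condition, B₃ε₁^{(k+1)} ≤ ε₀) and y₁ is admissible (leaf "averages of regular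
configurations are regular", [4] Props. 1–2 as [7] p. 278 invokes them), then the uniqueness clause of [7] Thm 1 at
level k puts U₁ on the orbit of U_k(y₁). [cite: Balaban1987RG1, (2.3) p.265; Balaban1985Variational, Thm 1 p.279;
Balaban1985UV3, (52) p.268] -/
theorem rel_uk_datum_of_crit (C : X → Y) (D : Y → W) (Uk : Y → X) (CritK : Y → X → Prop)
    (CritK1 : W → X → Prop) (R6 : Set X) (T : Set Y) (rel : X → X → Prop)
    (hlaw : ∀ x, CritK1 (D (C x)) x → CritK (C x) x)
    (huniqK : ∀ y ∈ T, ∀ x ∈ R6, C x = y → CritK y x → rel x (Uk y))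
    {U₁ : X} (hcrit : CritK1 (D (C U₁)) U₁) (hreg : U₁ ∈ R6) (hT : C U₁ ∈ T) : rel U₁ (Uk (C U₁)) :=
  huniqK (C U₁) hT U₁ hreg rfl (hlaw U₁ hcrit)

namespace LevelMin

variable {F : X → ℝ} {C : X → Y} {R : Y → Set X} {T : Set Y} {Uk : Y → X}

/-- **B10 p. 268 through the critical orbit: U_k(…, V_k^{(k)}) ∼ U_{k+1}.**  With (L1) = `LevelMin`, (L2) y⋆ an
effective minimiser over the admissible data coarsening to w: by `isMinOn_compSp_of_isMinOn_eff` U_k(y⋆) minimises A^η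
over the composite region, which is a relatively open piece of the constraint manifold 𝔅_{k+1}(w) containing it, so
(L3, leaf `hMinCrit`: local minimum on an open piece ⇒ critical) it is critical on 𝔅_{k+1}(w); it lies in the
level-(k+1) uniqueness region `R6₁` = (6)_{k+1} (L4, leaf `hscale`: the scale change of the regularity constants,
[7] (13)–(14) "C₁ = L³"); hence (L5, [7] Thm 1 at level k + 1: every critical configuration of (5) on 𝔅_{k+1}(w) in
(6)_{k+1} lies on the orbit of U_{k+1}(w)) it is gauge-related to U₁ = U_{k+1}(w).
[cite: Balaban1985UV3, (48)–(52) p.268; Balaban1985Variational, Thm 1 p.279, (13)–(14) p.280] -/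
theorem rel_uk_eff_of_unique_crit (h : LevelMin F C R T Uk) (D : Y → W) (CritK1 : W → X → Prop) (R6₁ : Set X)
    (rel : X → X → Prop) {w : W} {U₁ : X}
    (hMinCrit : ∀ x ∈ compSp R C D T w, IsMinOn F (compSp R C D T w) x → CritK1 w x)
    (huniq₁ : ∀ x ∈ R6₁, D (C x) = w → CritK1 w x → rel x U₁)
    {ys : Y} (hys : ys ∈ effFib D T w) (hmin : IsMinOn (F ∘ Uk) (effFib D T w) ys) (hscale : Uk ys ∈ R6₁) :
    rel (Uk ys) U₁ :=
  have hB := h.isMinOn_compSp_of_isMinOn_eff D hys hmin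
  huniq₁ _ hscale hB.1.2.2 (hMinCrit _ hB.1 hB.2)

/-- Uniqueness of composite minimisers modulo `rel`, DERIVED from the critical-orbit clause: two minimisers over the
composite region that lie in the uniqueness region are both critical (leaf `hMinCrit`) hence both on the orbit of U₁;
with `rel` an equivalence-like relation (symmetric and transitive through U₁) they are related.  This is the
hypothesis `huniq` of `rel_of_unique_min` in the form [7] provides it. [cite: Balaban1985Variational, Thm 1 p.279] -/
theorem unique_min_of_unique_crit (D : Y → W) (CritK1 : W → X → Prop) (R6₁ : Set X) (rel : X → X → Prop)
    {w : W} {U₁ : X} (hsymmtrans : ∀ a b, rel a U₁ → rel b U₁ → rel a b)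
    (hMinCrit : ∀ x ∈ compSp R C D T w, IsMinOn F (compSp R C D T w) x → CritK1 w x)
    (huniq₁ : ∀ x ∈ R6₁, D (C x) = w → CritK1 w x → rel x U₁) (hsub : compSp R C D T w ⊆ R6₁) :
    ∀ x ∈ compSp R C D T w, ∀ x' ∈ compSp R C D T w,
      IsMinOn F (compSp R C D T w) x → IsMinOn F (compSp R C D T w) x' → rel x x' :=
  fun x hx x' hx' hm hm' =>
    hsymmtrans x x' (huniq₁ x (hsub hx) hx.2.2 (hMinCrit x hx hm)) (huniq₁ x' (hsub hx') hx'.2.2 (hMinCrit x' hx' hm'))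

end LevelMin

/-- **Minimal in the big space from "unique critical" + interior attainment.**  If F attains its infimum on S at some
m ∈ S, every minimiser on S is critical on S, every critical point of S is `rel`-related to u ∈ S, and F is
`rel`-invariant (gauge invariance of A^η), then u minimises F on S.  This is the (unprinted) upgrade from [7] Thm 1's
"minimal orbit in (8), unique critical orbit in (6)" to "minimal in (6)"; its hypothesis `hattain` (attainment at an
INTERIOR point of the open space (6)) is the whole content — recorded because the cell's census (GAPS C-adv7-4, C-adv7-6,
C-adv4-13) found no consumer needing it. [cite: Balaban1985Variational, Thm 1 p.279] -/
theorem isMinOn_of_exists_min_of_unique_crit {S : Set X} {F : X → ℝ} {Crit : Set X → X → Prop}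
    (rel : X → X → Prop) (hF : ∀ x x', rel x x' → F x = F x') {u : X}
    (hattain : ∃ m ∈ S, IsMinOn F S m) (hmincrit : ∀ m ∈ S, IsMinOn F S m → Crit S m)
    (huniq : ∀ x ∈ S, Crit S x → rel x u) : IsMinOn F S u := by
  obtain ⟨m, hm, hmin⟩ := hattain
  have hEq : F m = F u := hF m u (huniq m hm (hmincrit m hm hmin))
  exact isMinOn_iff.2 fun x hx => by rw [← hEq]; exact isMinOn_iff.1 hmin x hx

end Abstract

/-! ## §2. The B10 instance: one induction step k → k + 1 of Sect. C (pp. 266–268)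

p. 266 [12], verbatim: *"We define the sets Λ_j, 𝔅 as in [5], i.e. Λ_j = Ω_j^{(j)}∖Ω_{j+1}^{(j)}, and we denote
Z_j = Ω_{j+1}^{(j)c} ⊂ T_{L^jη}^{(j)}. Gauge field configurations V_j are defined on Z_j, j = 0, 1, …, k − 1"*;
(40) *"χ_j = Π_{p∈Λ_j} χ({|V_j(∂p) − 1| < 2L²g_{j−1}p(g_{j−1})}), j = 1, …, k, (40) where we have denoted V_k = V."*;
(42) as quoted in the header; p. 267 [13] l. 1–2 *"The configuration U_k satisfies the following regularity condition
on Ω_k: |U_k(∂p) − 1| < 2L²B₃g_{k−1}p(g_{k−1})η²."* (= membership of U_k in the space (8) of [7] at level k with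
ε₁^{(k)} := 2L²g_{k−1}p(g_{k−1}), read on Ω_k where (L^kη) = 1: this answers cell GAPS G-B10-08 (i)'s question
"which B₃, why g_{k−1}": B₃ is [7] Thm 1's, and g_{k−1} enters through (40) at j = k, the small-field condition on the
datum V_k = V inherited from the previous step); p. 268 [14] as quoted in the header and in §1.

The carrier below NAMES these objects for one step; nothing is computed from a lattice (cell DIVERGENCE D-b10.8). -/

/-- Schematic carrier of ONE induction step k → k + 1 of B10 Sect. C: `Cfg` = configurations U on the fine lattice;
`KData` = k-data (V₀↾Λ₀, …, V_{k−1}↾Λ_{k−1}; V_k↾Ω_k^{(k)}) of (42) at level k (old Λ_k = Ω_k^{(k)}); `K1Data` =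
(k+1)-data (…; V_k↾Λ_k, new Λ_k = Ω_k^{(k)}∖Ω_{k+1}^{(k)}; V↾Λ_{k+1}), Λ_{k+1} = Ω_{k+1}^{(k+1)} (p. 268); `action` =
A^η; `kdatum U` = ((Ū^j↾Λ_j)_{j<k}, Ū^k↾Ω_k^{(k)}); `coarsen y` = (y's components; y_k↾Λ_k; ȳ_k↾Λ_{k+1}) so that
`coarsen (kdatum U)` is the (k+1)-datum of U (Ū^{k+1} = \overline{Ū^k}); `Uk y` = U_k(V₀, …, V_k), a chosen minimal
configuration of (42) ([7] Thm 1 at level k), `Usucc w` = U_{k+1}(w) likewise at level k + 1; `Reg8k y` = the region in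
which U_k(y) minimises (the space (8) of [7] at level k, ε₁^{(k)} = 2L²g_{k−1}p(g_{k−1}), global reading — or a
neighbourhood of the orbit, local reading D-B11-2); `AdmK` = admissible k-data ((7) of [7] with ε₁^{(k)} ≤ a₁ and the
small-field restrictions χ of (49)); `Reg6k`, `Reg6k1` = the uniqueness spaces (6) of [7] at levels k, k + 1 (constant
ε₀ ≤ a₀); `Gauge U U′` = "U, U′ differ by a gauge transformation" (the "(modulo a gauge transformation)" of (52));
`GaugeK` = the induced relation on k-data (gauge covariance of averages); `CritK y U` / `CritK1 w U` = "U is a critical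
configuration of (5) of [7] on 𝔅_k(y) / on 𝔅_{k+1}(w)" (r2's `B11.VarProblemX.IsCritical` at the two levels).
[cite: Balaban1985UV3, (40)–(42) p.266, (48)–(52) p.268; Balaban1985Variational, (2)–(8) pp.278–279] -/
structure StepData where
  Cfg : Type
  KData : Type
  K1Data : Type
  action : Cfg → ℝ
  kdatum : Cfg → KData
  coarsen : KData → K1Data
  Uk : KData → Cfg
  Usucc : K1Data → Cfg
  Reg8k : KData → Set Cfg
  AdmK : Set KData
  Reg6k : Set Cfg
  Reg6k1 : Set Cfg
  Gauge : Cfg → Cfg → Prop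
  GaugeK : KData → KData → Prop
  CritK : KData → Cfg → Prop
  CritK1 : K1Data → Cfg → Prop

namespace StepData

variable (S : StepData)

/-- The effective problem of (49) p. 268 [14]: admissible k-data with prescribed (k+1)-datum w ("V_k↾Z_k = V_k↾Z_k,
\overline{V_k} = V on Λ_{k+1}", the data V_j, j < k, frozen). [cite: Balaban1985UV3, (49) p.268] -/
def EffSpace (w : S.K1Data) : Set S.KData := effFib S.coarsen S.AdmK w

/-- The composite comparison region of (42) at level k + 1 over w, level-k regular (see `compSp`).
[cite: Balaban1985UV3, (42) p.266, p.268] -/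
def CompSpace (w : S.K1Data) : Set S.Cfg := compSp S.Reg8k S.kdatum S.coarsen S.AdmK w

/-- "V_k^{(k)}": y⋆ is an admissible k-datum coarsening to w which minimises y ↦ A^η(U_k(y)) over all such — B10's
DEFINITION of V_k^{(k)} (p. 268 [14]: *"the minimal configuration V_k^{(k)} of the functional A^η(U_k), which
satisfies the conditions V_k^{(k)}↾Z_k = V_k↾Z_k, \overline{V_k^{(k)}} = V on Λ_{k+1}"*).
[cite: Balaban1985UV3, (49) p.268] -/
def IsVkk (w : S.K1Data) (ys : S.KData) : Prop :=
  ys ∈ S.EffSpace w ∧ IsMinOn (S.action ∘ S.Uk) (S.EffSpace w) ys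

/-- **B10 p. 268 [14], (52) at A = 0: U_k(V₀, …, V_{k−1}, V_k^{(k)}) = U_{k+1} modulo a gauge transformation, AND it
minimises A^η over the composite region** — from the leaves
(L1) `hL1` : [7] Theorem 1 at level k in the reading `LevelMin` (U_k(y) ∈ (8)_k has datum y and minimises A^η over
      (8)_k ∩ {Ū^j = y_j}) — §4 derives it from `B11Thm1.Thm1At` under the dictionary `B11Dict`;
(L2) `hL2` : y⋆ is V_k^{(k)} (`IsVkk`, B10's definition; its EXISTENCE is asserted in print — see
      `exists_Vkk_of_Usucc_min` for what the papers offer);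
(L3) `hL3` : a minimiser of A^η over the composite region (a relatively open subset of the constraint manifold
      𝔅_{k+1}(w): (2), (7) of [7] are strict inequalities) is a critical configuration of (5) on 𝔅_{k+1}(w) [standard;
      not printed];
(L4) `hL4` : U_k(y⋆) ∈ (6)_{k+1} = 𝔘_{k+1}({Ω_j}_{j≤k+1}, ε₀): from U_k(y⋆) ∈ (8)_k by the scale change of the
      constants of (2) between the two levels ([7] (13)–(14) prints the instance "B₃L³ε₁", "C₁ = L³" for its own
      passage k − 1 → k; B10 prints none), under which c₁B₃ε₁^{(k)} ≤ ε₀ ≤ a₀ suffices (`eps0_window`; GAPS G-B10-11);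
(L5) `hL5` : [7] Theorem 1 at level k + 1, uniqueness clause, for the datum w ((7) with ε₁^{(k+1)} = 2L²g_kp(g_k) ≤ a₁,
      B₃ε₁^{(k+1)} ≤ ε₀ ≤ a₀): every critical configuration of (5) on 𝔅_{k+1}(w) lying in (6)_{k+1} is a gauge
      transform of U_{k+1}(w).
[cite: Balaban1985UV3, (48)–(52) p.268, (42) p.266; Balaban1985Variational, Thm 1 p.279, (13)–(14) p.280] -/
theorem gauge_Uk_substitute_Usucc (w : S.K1Data) (ys : S.KData)
    (hL1 : LevelMin S.action S.kdatum S.Reg8k S.AdmK S.Uk) (hL2 : S.IsVkk w ys)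
    (hL3 : ∀ x ∈ S.CompSpace w, IsMinOn S.action (S.CompSpace w) x → S.CritK1 w x)
    (hL4 : S.Uk ys ∈ S.Reg6k1)
    (hL5 : ∀ x ∈ S.Reg6k1, S.coarsen (S.kdatum x) = w → S.CritK1 w x → S.Gauge x (S.Usucc w)) :
    S.Gauge (S.Uk ys) (S.Usucc w) ∧ S.Uk ys ∈ S.CompSpace w ∧ IsMinOn S.action (S.CompSpace w) (S.Uk ys) :=
  ⟨hL1.rel_uk_eff_of_unique_crit S.coarsen S.CritK1 S.Reg6k1 S.Gauge hL3 hL5 hL2.1 hL2.2 hL4,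
    hL1.isMinOn_compSp_of_isMinOn_eff S.coarsen hL2.1 hL2.2⟩

/-- **The B12 (2.3) direction at B10's step: U_{k+1}(w) is a gauge transform of U_k(Ū^k_{k+1}(w))** (= cell GAPS
C-adv7-6 (L2), here over the B10 carrier) — from the leaves
(M0) `hM0` : critical on 𝔅_{k+1}(coarsen (kdatum U)) ⇒ critical on the level-k fibre 𝔅_k(kdatum U) (restriction of
      criticality to a sub-manifold through the point; `critLaw_of_restricts`);
(M1) `hM1` : U_{k+1}(w) is a critical configuration of (5) on 𝔅_{k+1}(w) and (M2) `hM2` its (k+1)-datum is w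
      ([7] Thm 1 at level k + 1: minimal ⇒ critical; constraint (3));
(M3) `hM3` : U_{k+1}(w) ∈ (6)_k ((8)_{k+1} ⊆ (6)_k: drop the Ω_{k+1}-condition of (2) and compare the level-j
      conditions, j ≤ k, in the units of the two levels — c₂B₃ε₁^{(k+1)} ≤ ε₀ with the scale-change constant of (L4)'s
      kind; in [7]'s absolute units (2) the conditions for j ≤ k coincide and c₂ = 1);
(M4) `hM4` : the k-datum Ū^k_{k+1} of U_{k+1}(w) is admissible ([4] Props. 1–2: averages of regular configurations
      satisfy (7), as [7] p. 278 *"by Proposition 2 [4] the configuration V satisfies (7) with ε₁ = O(ε₀)"*);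
(M5) `hM5` : [7] Thm 1 at level k, uniqueness clause: every critical configuration of (5) on 𝔅_k(y), y admissible,
      lying in (6)_k is a gauge transform of U_k(y).
[cite: Balaban1987RG1, (2.3) p.265; Balaban1985UV3, (52) p.268; Balaban1985Variational, Thm 1 p.279, p.278] -/
theorem gauge_Usucc_Uk_datum (w : S.K1Data)
    (hM0 : ∀ x, S.CritK1 (S.coarsen (S.kdatum x)) x → S.CritK (S.kdatum x) x)
    (hM1 : S.CritK1 w (S.Usucc w)) (hM2 : S.coarsen (S.kdatum (S.Usucc w)) = w) (hM3 : S.Usucc w ∈ S.Reg6k)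
    (hM4 : S.kdatum (S.Usucc w) ∈ S.AdmK)
    (hM5 : ∀ y ∈ S.AdmK, ∀ x ∈ S.Reg6k, S.kdatum x = y → S.CritK y x → S.Gauge x (S.Uk y)) :
    S.Gauge (S.Usucc w) (S.Uk (S.kdatum (S.Usucc w))) :=
  rel_uk_datum_of_crit S.kdatum S.coarsen S.Uk S.CritK S.CritK1 S.Reg6k S.AdmK S.Gauge hM0 hM5
    (by rw [hM2]; exact hM1) hM3 hM4

/-- **What the papers offer for the EXISTENCE of V_k^{(k)}**: if U_{k+1}(w) lies in the composite region over w
(level-k regular with admissible averages) and minimises A^η over it, then V_k^{(k)} exists, namely Ū^k_{k+1}(w) (B12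
(2.3)'s definition), and then U_k(V_k^{(k)}) has the action of U_{k+1}.  [7] Thm 1 (8) at level k + 1 gives minimality
of U_{k+1}(w) over the level-(k+1) space (8)_{k+1} ∩ 𝔅_{k+1}(w); that this contains / is contained in the level-k
region at B10's constants (ε₁^{(k+1)} = 2L²g_kp(g_k) versus ε₁^{(k)} = 2L²g_{k−1}p(g_{k−1})) is NOT available either
way — cell GAPS G-B10-11 (B10 asserts the existence: p. 268 "We take the minimal configuration V_k^{(k)}").
[cite: Balaban1985UV3, p.268; Balaban1987RG1, (2.3) p.265; Balaban1985Variational, (8) p.279] -/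
theorem exists_Vkk_of_Usucc_min (w : S.K1Data) (hL1 : LevelMin S.action S.kdatum S.Reg8k S.AdmK S.Uk)
    (hmem : S.Usucc w ∈ S.CompSpace w) (hmin : IsMinOn S.action (S.CompSpace w) (S.Usucc w)) :
    S.IsVkk w (S.kdatum (S.Usucc w)) ∧ S.action (S.Uk (S.kdatum (S.Usucc w))) = S.action (S.Usucc w) :=
  ⟨hL1.isMinOn_eff_datum S.coarsen hmem hmin, (hL1.isMinOn_compSp_datum S.coarsen hmem hmin).1⟩

/-- **Uniqueness of V_k^{(k)} modulo gauge** (so that "the minimal configuration V_k^{(k)}" is well defined up to the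
gauge freedom (9)/(49) removes): two effective minimisers are `GaugeK`-related, given (L1), uniqueness of composite
minimisers modulo `Gauge` (e.g. `LevelMin.unique_min_of_unique_crit` from (L3)–(L5)) and gauge covariance of the datum
map (*"The gauge covariance of the averages"*, B12 p. 265 [17]; [4]). [cite: Balaban1985UV3, (49) p.268;
Balaban1987RG1, p.265] -/
theorem Vkk_unique_mod_gauge (w : S.K1Data) (hL1 : LevelMin S.action S.kdatum S.Reg8k S.AdmK S.Uk)
    (hcov : ∀ x x', S.Gauge x x' → S.GaugeK (S.kdatum x) (S.kdatum x'))
    (huniq : ∀ x ∈ S.CompSpace w, ∀ x' ∈ S.CompSpace w,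
      IsMinOn S.action (S.CompSpace w) x → IsMinOn S.action (S.CompSpace w) x' → S.Gauge x x')
    {ys ys' : S.KData} (h : S.IsVkk w ys) (h' : S.IsVkk w ys') : S.GaugeK ys ys' :=
  hL1.eff_min_unique_mod S.coarsen S.Gauge S.GaugeK hcov huniq h.1 h.2 h'.1 h'.2

end StepData

/-- **The ε₀-window of the two uses of [7] Theorem 1.**  Leaf (L4) needs c₁B₃ε₁^{(k)} ≤ ε₀ (the level-k-regular
configuration U_k(V_k^{(k)}) must lie in the level-(k+1) uniqueness space (6)_{k+1}; c₁ = the scale-change constant of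
the conditions (2) between the two levels — [7] (13)–(14) prints the instance *"B₃L³ε₁"*, *"C₁ = L³"* for its own
passage k − 1 → k; B10 prints none), and leaf (L5) needs c₂B₃ε₁^{(k+1)} ≤ ε₀ ≤ a₀ (the uniqueness clause at level
k + 1, c₂ = 1 in [7]'s own units).  The window is non-empty iff both lower bounds are ≤ a₀ — a "g_{k−1}, g_k
sufficiently small" condition of the kind p. 259 [5] states for the first step only (*"For g₀ sufficiently small
2L²g₀p(g₀) < a₁, where a₁ is the constant in Theorem 1 [7]"*); cell GAPS G-B10-11.
[cite: Balaban1985UV3, p.259, p.268; Balaban1985Variational, Thm 1 p.279, (13)–(14) p.280] -/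
theorem eps0_window (c₁ c₂ B₃ a₀ e₁k e₁k1 : ℝ) (h₁ : c₁ * B₃ * e₁k ≤ a₀) (h₂ : c₂ * B₃ * e₁k1 ≤ a₀) :
    ∃ ε₀ : ℝ, c₂ * B₃ * e₁k1 ≤ ε₀ ∧ c₁ * B₃ * e₁k ≤ ε₀ ∧ ε₀ ≤ a₀ :=
  ⟨max (c₁ * B₃ * e₁k) (c₂ * B₃ * e₁k1), le_max_right _ _, le_max_left _ _, max_le h₁ h₂⟩

/-- The instance c₁ = L³, c₂ = 1 of `eps0_window` ([7]'s absolute units (2): plaquette conditions scale by L², bond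
conditions by L³ between consecutive levels — pv12's `B11Thm1.ineq13_plaquette_factor`, `B11Thm1.ineq13_bond_factor` —
whence (13) *"B₃L³ε₁"*): with ε₁^{(k)} ≤ ε₁^{(k+1)} (B10: ε₁^{(j)} = 2L²g_{j−1}p(g_{j−1}), non-decreasing along the
flow as long as g_jp(g_j) is), L ≥ 1 and B₃ ≥ 0, the single smallness condition L³B₃ε₁^{(k+1)} ≤ a₀ opens the window.
Whether these are B10's inter-step constants is NOT settled here (cell GAPS G-B10-11).
[cite: Balaban1985Variational, (13)–(14) p.280; Balaban1985UV3, (40) p.266] -/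
theorem eps0_window_L3 (L B₃ a₀ e₁k e₁k1 : ℝ) (hL : 1 ≤ L) (hB₃ : 0 ≤ B₃) (hmono : e₁k ≤ e₁k1) (he : 0 ≤ e₁k1)
    (hsmall : L ^ 3 * B₃ * e₁k1 ≤ a₀) :
    ∃ ε₀ : ℝ, 1 * B₃ * e₁k1 ≤ ε₀ ∧ L ^ 3 * B₃ * e₁k ≤ ε₀ ∧ ε₀ ≤ a₀ := by
  refine eps0_window (L ^ 3) 1 B₃ a₀ e₁k e₁k1 ?_ (le_trans ?_ hsmall)
  · have hL3 : 0 ≤ L ^ 3 := by positivity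
    have h0 : 0 ≤ L ^ 3 * B₃ := mul_nonneg hL3 hB₃
    calc L ^ 3 * B₃ * e₁k ≤ L ^ 3 * B₃ * e₁k1 := mul_le_mul_of_nonneg_left hmono h0
      _ ≤ a₀ := hsmall
  · have hL3 : 1 ≤ L ^ 3 := one_le_pow₀ hL
    have h0 : 0 ≤ B₃ * e₁k1 := mul_nonneg hB₃ he
    calc 1 * B₃ * e₁k1 = 1 * (B₃ * e₁k1) := by ring
      _ ≤ L ^ 3 * (B₃ * e₁k1) := mul_le_mul_of_nonneg_right hL3 h0
      _ = L ^ 3 * B₃ * e₁k1 := by ring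

/-! ## §3. The d = 4 twin: B12 p. 265 [17] (2.2)–(2.3) (recorded, not typed)

B12 (CMP **109**) p. 265 [17], verbatim: *"We calculate the integral (2.1) applying the saddle point method. At first we
look for critical points of the function V → 𝐆(V) + A(U_k(V)), V : V̄ = W. (2.2) Under the above regularity
assumptions there exists the exactly one critical point, which is obtained by taking the critical orbit of the function
A(U_k(V)) considered on the subspace, and choosing the element of the orbit satisfying the axial gauge conditions
𝐆(V) = 0. This critical configuration, which is a minimum of the function (2.2), is denoted by V^{(k)} = V^{(k)}(W),
and is related to the minimal configuration U_{k+1}(W) in the axial gauge by the equality V^{(k)} = Ū^k_{k+1} =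
M^k(U_{k+1}). (2.3)"*.  Dictionary to §1–§2 (one scale of data instead of B10's history of data; otherwise identical):
X = configurations on T_η, Y = V on T^{(k)}, W = W on T^{(k+1)}, C = M^k (k-fold average), D = one more average,
F = A, Uk = U_k(·), x₁ = U_{k+1}(W), P = 𝐆 ≥ 0 vanishing exactly on the axial slice.  Then: (2.3) modulo gauge =
`rel_uk_datum_of_crit` (cell GAPS C-adv7-6 (L2): uniqueness + regularity fit only); "exactly one critical point … in
the axial gauge" = uniqueness modulo gauge + `eff_min_eq_on_slice`; "which is a minimum of the function (2.2)" =
`LevelMin.isMinOn_eff_datum` + `isMinOn_penalty_of_isMinOn`, whose hypothesis is minimality of U_{k+1}(W) over a region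
containing every U_k(V), V in the χ_k-domain (cell GAPS C-adv7-6 (L1): minimality within the regular space suffices
under B12's set-up "U_k(V) ∈ U_k(ε₀)", "U_{k+1}(W) ∈ U_{k+1}(ε₀)").  The B12 modules of the cell (`…B12`, `…B12Sec2to5`,
…) are not imported or modified; this section only records that ONE lemma serves both papers. -/

/-! ## §4. The edge to [7] Theorem 1 AS TYPED IN THE TREE (`B11Thm1.Thm1At`, r2's carrier `B11.VarProblemX`) -/

section EdgeB11

/-- DICTIONARY between r2's primitive fields of `B11.VarProblem(X)` and the minimisation vocabulary of §1, for ONE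
variational problem P (one level) equipped with an action functional `act` (the functional (5) of [7]) and a datum map
`kd` (U ↦ its averages (Ū^j↾Λ_j)_j): (i) `InB V U` ("Ū^j = V on Λ_j, j = 0, …, k", (3)) iff the datum of U is V;
(ii) "U lies on a minimal orbit of (5) in 𝔘(e) ∩ 𝔅(V)" (r2's `OnMinimalOrbit e V U`) ⇒ U lies in that space and its
action is ≤ the action of every configuration of that space (p. 278 [2]: *"we will prove that there exists a minimal
orbit. Elements of the minimal orbit are called minimal configurations"*; GLOBAL-in-(8) reading — the local reading of
cell DIVERGENCE D-B11-2 would replace 𝔘(e) by a neighbourhood of the orbit, which §1's `R y` allows); (iii) "the orbit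
of U is the unique critical orbit in (6)" (r2's `UniqueCriticalOrbit ε₀ V U`) ⇒ every critical configuration of (5)
on 𝔅(V) lying in 𝔘(ε₀) is on the orbit of U (the elimination direction of the words of Thm 1; `B11.VarProblemX.Laws`
(iv) is the introduction direction).  Hypotheses of the edge below, never asserted. [cite: Balaban1985Variational,
(3)–(8) pp.278–279] -/
structure B11Dict (P : B11.VarProblemX) (act : P.Cfg → ℝ) (kd : P.Cfg → P.Bdry) : Prop where
  inB_iff : ∀ (V : P.Bdry) (U : P.Cfg), P.InB V U ↔ kd U = V
  min_of_onMinimalOrbit : ∀ (e : ℝ) (V : P.Bdry) (U : P.Cfg), P.OnMinimalOrbit e V U →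
    P.InU e U ∧ P.InB V U ∧ ∀ U' : P.Cfg, P.InU e U' → P.InB V U' → act U ≤ act U'
  sameOrbit_of_unique : ∀ (ε₀ : ℝ) (V : P.Bdry) (U : P.Cfg), P.UniqueCriticalOrbit ε₀ V U →
    ∀ U' : P.Cfg, P.InU ε₀ U' → P.InB V U' → P.IsCritical V U' → P.SameOrbit U' U

/-- Leaf (L5)/(M5) WITHOUT dictionary clause (iii), from r2's typed notion behind [7] Proposition 7
(`B11.VarProblemX.AtMostOneCriticalOrbit ε₀ V`: any two critical configurations of (5) in 𝔘(ε₀) ∩ 𝔅(V) lie on one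
orbit) and one critical configuration U in that space (e.g. the minimal one, `B11.VarProblemX.Laws` (ii)): every
critical configuration of (5) on 𝔅(V) in 𝔘(ε₀) lies on the orbit of U. [cite: Balaban1985Variational, Prop. 7 p.299] -/
theorem sameOrbit_of_atMostOne (P : B11.VarProblemX) {ε₀ : ℝ} {V : P.Bdry} {U : P.Cfg}
    (h : P.AtMostOneCriticalOrbit ε₀ V) (hU : P.InU ε₀ U) (hB : P.InB V U) (hc : P.IsCritical V U) :
    ∀ U' : P.Cfg, P.InU ε₀ U' → P.InB V U' → P.IsCritical V U' → P.SameOrbit U' U :=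
  fun U' hU' hB' hc' => h U' U hU' hB' hc' hU hB hc

/-- **[7] Theorem 1 at given constants ⇒ leaf (L1) with R = the space (8) and T = {V : (7) with ε₁}, and leaf
(L5)/(M5) in the shape §2 uses** — for ONE level (one `B11.VarProblemX`, i.e. one datum (k; {Ω_j}; 𝔅_k)), from pv12's
`B11Thm1.Thm1At C P` (the body of r2's `B11.Thm1Printed`, cf. `B11Thm1.thm1Printed_iff`) under the dictionary
`B11Dict`: for 0 < ε₁ ≤ a₁ there is a minimiser MAP V ↦ U_k(V) (a choice of one minimal configuration per regular datum,
by the axiom of choice over the clause (8); arbitrary on irregular data) satisfying `LevelMin act kd (8) (7) U_k`, and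
for B₃ε₁ ≤ ε₀ ≤ a₀ every critical configuration of (5) on 𝔅_k(V), V regular, lying in 𝔘_k(ε₀) is on the orbit of
U_k(V).  (B10 applies this at level k with ε₁ = ε₁^{(k)} = 2L²g_{k−1}p(g_{k−1}) — p. 267 [13] l. 1–2 — and at level
k + 1 with ε₁^{(k+1)} = 2L²g_kp(g_k).) [cite: Balaban1985Variational, Thm 1 p.279; Balaban1985UV3, (42) p.266, p.267] -/
theorem levelMin_of_thm1At (C : B11Thm1.Consts) (P : B11.VarProblemX) (h : B11Thm1.Thm1At C P.toVarProblem)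
    (act : P.Cfg → ℝ) (kd : P.Cfg → P.Bdry) (hd : B11Dict P act kd) (hne : Nonempty P.Cfg)
    {ε₁ : ℝ} (hε₁ : 0 < ε₁) (hε₁a : ε₁ ≤ C.a₁) :
    ∃ Uk : P.Bdry → P.Cfg,
      LevelMin act kd (fun _ => {U | P.InU (C.B₃ * ε₁) U}) {V | P.Reg7 ε₁ V} Uk ∧
      (∀ V : P.Bdry, P.Reg7 ε₁ V → P.OnMinimalOrbit (C.B₃ * ε₁) V (Uk V)) ∧
      ∀ ε₀ : ℝ, C.B₃ * ε₁ ≤ ε₀ → ε₀ ≤ C.a₀ → ∀ V : P.Bdry, P.Reg7 ε₁ V →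
        ∀ U' : P.Cfg, P.InU ε₀ U' → kd U' = V → P.IsCritical V U' → P.SameOrbit U' (Uk V) := by
  classical
  -- Theorem 1 at the constants C, for the regular data V: clause (8) gives the minimal configuration to choose
  have H : ∀ V : P.Bdry, P.Reg7 ε₁ V →
      B11Thm1.Exists8 P.toVarProblem C.B₃ ε₁ V ∧ B11Thm1.Unique6 P.toVarProblem C.a₀ C.B₃ ε₁ V :=
    fun V hV => ⟨(h ε₁ hε₁ hε₁a V hV).1, (h ε₁ hε₁ hε₁a V hV).2.1⟩
  let Uk : P.Bdry → P.Cfg := fun V =>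
    if hV : P.Reg7 ε₁ V then Classical.choose (H V hV).1 else Classical.choice hne
  have hUk : ∀ V : P.Bdry, ∀ hV : P.Reg7 ε₁ V, Uk V = Classical.choose (H V hV).1 := fun V hV => dif_pos hV
  have hspec : ∀ V : P.Bdry, P.Reg7 ε₁ V →
      P.InU (C.B₃ * ε₁) (Uk V) ∧ P.InB V (Uk V) ∧ P.OnMinimalOrbit (C.B₃ * ε₁) V (Uk V) := by
    intro V hV
    rw [hUk V hV]
    exact Classical.choose_spec (H V hV).1
  refine ⟨Uk, ⟨?_, ?_, ?_⟩, fun V hV => (hspec V hV).2.2, ?_⟩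
  · intro V hV
    exact (hspec V hV).1
  · intro V hV
    exact (hd.inB_iff V (Uk V)).1 (hspec V hV).2.1
  · intro V hV x hx hxV
    have hmin := (hd.min_of_onMinimalOrbit (C.B₃ * ε₁) V (Uk V) (hspec V hV).2.2).2.2
    exact hmin x hx ((hd.inB_iff V x).2 hxV)
  · intro ε₀ hlo hhi V hV U' hU' hdat hcrit
    have huniq : P.UniqueCriticalOrbit ε₀ V (Uk V) := (H V hV).2 ε₀ hlo hhi (Uk V) (hspec V hV).2.2
    exact hd.sameOrbit_of_unique ε₀ V (Uk V) huniq U' hU' ((hd.inB_iff V U').2 hdat) hcrit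

/-- The same edge from r2's family form `B11.Thm1Printed fam` (constants chosen before the member `i : I`), via pv12's
`B11Thm1.thm1Printed_iff`. [cite: Balaban1985Variational, Thm 1 p.279] -/
theorem levelMin_of_thm1Printed {I : Type} (fam : I → B11.VarProblemX)
    (h : B11.Thm1Printed (fun i => (fam i).toVarProblem)) :
    ∃ C : B11Thm1.Consts, ∀ (i : I) (act : (fam i).Cfg → ℝ) (kd : (fam i).Cfg → (fam i).Bdry),
      B11Dict (fam i) act kd → Nonempty (fam i).Cfg → ∀ ε₁ : ℝ, 0 < ε₁ → ε₁ ≤ C.a₁ →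
        ∃ Uk : (fam i).Bdry → (fam i).Cfg,
          LevelMin act kd (fun _ => {U | (fam i).InU (C.B₃ * ε₁) U}) {V | (fam i).Reg7 ε₁ V} Uk ∧
          (∀ V, (fam i).Reg7 ε₁ V → (fam i).OnMinimalOrbit (C.B₃ * ε₁) V (Uk V)) ∧
          ∀ ε₀ : ℝ, C.B₃ * ε₁ ≤ ε₀ → ε₀ ≤ C.a₀ → ∀ V, (fam i).Reg7 ε₁ V →
            ∀ U', (fam i).InU ε₀ U' → kd U' = V → (fam i).IsCritical V U' → (fam i).SameOrbit U' (Uk V) := by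
  obtain ⟨C, hC⟩ := (B11Thm1.thm1Printed_iff _).1 h
  exact ⟨C, fun i act kd hd hne ε₁ hε₁ hε₁a => levelMin_of_thm1At C (fam i) (hC i) act kd hd hne hε₁ hε₁a⟩

end EdgeB11

end Literature.MathematicalPhysics.QuantumFieldTheory.Balaban1983to89.B10NestedMinimizer
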